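import Literature.AnabelianGeometry.SemiGraphs.PSCSeparatingCoveringsIrreducibleMultiNodalAll
import Literature.AnabelianGeometry.SemiGraphs.PSCSeparatingCoveringsTwoComponentUnmarkedEdgesOneCusp
import HarnessLib

/-!
# [CombGC] Prop. 1.2, proof p. 9: EDGE-LIKE separating coverings at IRREDUCIBLE MULTI-NODAL data with ONE marked point (rows F-2827, F-2829, F-2830)

Mochizuki, *A combinatorial version of the Grothendieck conjecture*, Tohoku Math. J. **59** (2007)
[CombGC], PROOF of Proposition 1.2, author's manuscript p. 9, the resp'd (edge) case: "there exists a
finite étale … `Π_G`-covering `G' → G` whose restriction to the anabelioid `G_{e₂}` is trivial …, but whose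
restriction to the anabelioid `G_{e₁}` is nontrivial" [cite: MochizukiCombGC2007, Prop 1.2 proof p.9]; typed
LEVEL-WISE as `PSCDatum.EdgeLikeSeparatingCoverings` (abc-iut-w4-d081, row P12-L01-E; abc-iut FACT-LIST
row F-2827, the edge conjunct of F-2829 / F-2830 — schemata whose universal closures are refuted as typed;
the instance forms at genuine carriers are the content).

PROOF-ONLY file (abc-iut-f-166 gen 6, row «ONE-CUSP-CORNERS» (6); 0 definitions).  The carrier: the data of
IRREDUCIBLE `k`-NODAL SHAPE of abc-iut-f-164 (one vertex with `k` loops, node groups `cl ι⟨b_m⟩`, `m < k`,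
over a profinite pro-`Σ` completion `ι : Γ_{g,r} → Π` of the smoothing) with EXACTLY ONE marked point
(`r = 1`) — the corner left open by `PSCSeparatingCoveringsIrreducibleMultiNodalEdges.lean` (`r ≥ 2`).  The
loops `b_m` are letters of the `c₀`-eliminating free basis of `Γ_{g,1}`, but the lone cusp
`c₀ = (∏_i [a_i,b_i])⁻¹` is a boundary word, a member of no free basis, and dies under every abelian
character: the rank-one engine cannot be applied to it.  Pairs of level edges are separated as follows:

* loop / same loop — gen 3's fibred twist `freeFactor_exists_open_separating_sameVertex` (rank-one factor
  `{b_m}`); loop / other loop — the free-factor projection `freeFactor_exists_open_separating_crossVertex`;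
* loop alive / cusp killed — the handle character `b_m ↦ 1 ∈ ℤ/ℓ^{[Π:V]}` (abc-iut-f-164's
  `exists_handleCuspCharacter`; it kills `c₀`) through `IsProSigmaCompletion.exists_open_separating_of_hom`;
* cusp alive / loop `b_m` killed — the NON-ABELIAN handle-cusp homomorphism
  `(a_{i₀}, b_{i₀}, c₀) ↦ (X, Y, Z⁻¹)` into the Heisenberg group mod `ℓ^{[Π:V]}` at a handle `i₀ ≠ m`
  (`exists_hom_handle_cusp`; available when `k < g` or `g ≥ 2`), through the same lemma;
* cusp / cusp — abc-iut-f-164's boundary-node theorem `boundaryNode_exists_open_separating_sameEdge` for the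
  improper free factor `B = Γ_{g,1}` (`θ = id`: `c₀` is the boundary of the whole once-punctured surface).

* `edgeLikeSeparatingCoverings_of_irreducibleMultiNodal_oneCusp` — **F-2827** (`V' := V`) at EVERY such datum
  (`r = 1`, `k ≤ g`, `k < g ∨ 2 ≤ g`); `edgeLikeSeparatingCoverings_of_irreducibleMultiNodal'` — F-2827 at
  every irreducible `k`-nodal datum with `r ≥ 1` (abc-iut-f-164's theorem for `r ≥ 2` BY NAME);
* `separatingCoverings_of_irreducibleMultiNodal'`, `prop12_of_irreducibleMultiNodal'` — **F-2829** (all three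
  conjuncts; F-2826 abc-iut-f-164's `verticialSeparatingCoverings_of_irreducibleMultiNodal'`, which carries
  `k < g ∨ 2 ≤ r`, and F-2828 gen 4's `unrVerticialSeparatingCoverings_of_irreducibleMultiNodal`) and all five
  typed clauses of Prop. 1.2 (i)(ii), at every irreducible `k`-nodal datum with `r ≥ 1`, `k < g ∨ 2 ≤ r`;
* `irreducibleMultiNodalOrigin_prop12_rows'` — F-2830 ∧ F-0438 ∧ F-0459 rows datum-wise at every origin of
  such data; `exists_irreducibleMultiNodalOneCuspOrigin_prop12_holds_all` — NON-VACUITY at the corner: the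
  origin of all irreducible `k`-nodal data with `r ≥ 1`, `k < g ∨ 2 ≤ r`, inhabited by `Γ_{3,1}` cut along
  two loops (vertex genus `1`, two nodes, one cusp), carries **F-2830, F-0438, F-0459**.

Honest-open after this file (one-vertex data with one marked point): `k = g` (rational normalisation) — there
F-2826 needs a separating letter the cut-off twist does not have.  The `k = 1` case in the ONE-NODAL typing
(`Δ_irr`, node group `cl ι⟨b_0⟩`, `hN : ∀ n, n = n₀`) is abc-iut-f-060's row (loop/cusp twists); this file is
stated in the multi-nodal typing only.  Instance forms at data of the shape of genuine irreducible nodal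
curves: consistency evidence for the typed rows, not the printed theorems for all pointed stable curves.
Nothing here takes a side on [IUTchIII] Cor. 3.12.
-/

noncomputable section

namespace Literature.AnabelianGeometry.SemiGraphs

open scoped Pointwise
open Multiplicative
open Literature.AnabelianGeometry.Anabelioids (IsSigmaInteger)
open Literature.GroupTheory.CombinatorialGroupTheory
open Literature.GroupTheory.CombinatorialGroupTheory.PuncturedSurfaceGroup (a b c cuspInertia
  exists_freeGroupBasis_elim_zero exists_handleCuspCharacter exists_hom_handle_cusp)
open Literature.GroupTheory.CombinatorialGroupTheory.FreeFactorFibredTwist (lift_apply_basis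
  mem_closure_range_basis)
open SemiGraphOfAnabelioids (IsProSigmaCompletion)
open SemiGraphOfAnabelioids.IsProSigmaCompletion (freeFactor_exists_open_separating_sameVertex
  freeFactor_exists_open_separating_crossVertex boundaryNode_exists_open_separating_sameEdge
  exists_open_separating_of_hom)

namespace PSCDatum

section Datum

variable {P : Type} [Group P] [TopologicalSpace P] [IsTopologicalGroup P]
variable [CompactSpace P] [TotallyDisconnectedSpace P] {Sigma : Set ℕ} {g r : ℕ}

/-- **Row P12-L01-E / F-2827 (`EdgeLikeSeparatingCoverings`, `V' := V`) at EVERY irreducible `k`-nodal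
datum with ONE marked point** (`r = 1`, `k ≤ g`, `k < g ∨ 2 ≤ g`; node groups `cl ι⟨b_m⟩`, the cusp group
`cl ι⟨c₀⟩`): loop/loop pairs by the rank-one free-factor engines, loop-alive/cusp-killed by an abelian handle
character, cusp-alive/loop-killed by a Heisenberg handle-cusp homomorphism at another handle, cusp/cusp by
the boundary-node theorem for `Γ_{g,1}` itself. [cite: MochizukiCombGC2007, Prop 1.2 proof p.9] -/
theorem edgeLikeSeparatingCoverings_of_irreducibleMultiNodal_oneCusp (hne : Sigma.Nonempty)
    (hprime : ∀ p ∈ Sigma, p.Prime) (ι : PuncturedSurfaceGroup g r →* P)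
    (hι : IsProSigmaCompletion Sigma ι) (G : PSCDatum P) {k : ℕ} (hk : k ≤ g) (hkg : k < g ∨ 2 ≤ g)
    (hg : 1 ≤ g) (hr : r = 1) (e : G.graph.C ≃ Fin r)
    (hC : ∀ c', G.cuspGp c' = ((cuspInertia (g := g) (e c')).map ι).topologicalClosure)
    (eN : G.graph.N ≃ Fin k)
    (hE : ∀ m, G.nodeGp m = ((Subgroup.zpowers
      (PuncturedSurfaceGroup.b (r := r) (Fin.castLE hk (eN m)))).map ι).topologicalClosure) :
    G.EdgeLikeSeparatingCoverings := by
  classical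
  subst hr
  obtain ⟨ℓ, hℓS⟩ := hne
  have hℓ : ℓ.Prime := hprime ℓ hℓS
  have hSig : ∃ ℓ ∈ Sigma, ℓ.Prime := ⟨ℓ, hℓS, hℓ⟩
  -- the `c₀`-eliminating free basis `{a_i, b_i}` of `Γ_{g,1}`
  obtain ⟨b₀, ha₀, hb₀, -⟩ := exists_freeGroupBasis_elim_zero g 0
  have hidB : (MonoidHom.id (PuncturedSurfaceGroup g 1)).range = Subgroup.closure (b₀ '' Set.univ) := by
    ext x
    exact ⟨fun _ => by rw [Set.image_univ]; exact mem_closure_range_basis b₀ x, fun _ => ⟨x, rfl⟩⟩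
  -- the edge groups
  have hc0 : ∀ c', e c' = 0 := fun c' => Fin.fin_one_eq_zero (e c')
  have hEn : ∀ n, G.edgeGp (Sum.inl n) =
      ((Subgroup.zpowers (PuncturedSurfaceGroup.b (r := 1) (Fin.castLE hk (eN n)))).map ι).topologicalClosure :=
    fun n => hE n
  have hEn' : ∀ n, G.edgeGp (Sum.inl n) =
      ((Subgroup.closure (b₀ '' {Sum.inl (Fin.castLE hk (eN n), true)})).map ι).topologicalClosure := fun n => by
    rw [hEn n, Set.image_singleton, hb₀, Subgroup.zpowers_eq_closure]
  have hEc : ∀ c', G.edgeGp (Sum.inr c') = ((Subgroup.zpowers (c 0)).map ι).topologicalClosure :=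
    fun c' => by rw [show G.edgeGp (Sum.inr c') = G.cuspGp c' from rfl, hC c', hc0 c']; rfl
  have hιb : ∀ n, ι (PuncturedSurfaceGroup.b (Fin.castLE hk (eN n))) ∈ G.edgeGp (Sum.inl n) := fun n => by
    rw [hEn]
    exact Subgroup.le_topologicalClosure _ (Subgroup.mem_map_of_mem ι (Subgroup.mem_zpowers _))
  have hιc : ∀ c', ι (c 0) ∈ G.edgeGp (Sum.inr c') := fun c' => by
    rw [hEc]
    exact Subgroup.le_topologicalClosure _ (Subgroup.mem_map_of_mem ι (Subgroup.mem_zpowers _))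
  intro V hVn hVo
  haveI := hVn
  refine ⟨V, hVn, hVo, le_rfl, ?_⟩
  -- the finite `Σ`-targets mod `ℓ^m`, `m = [Π : V]`
  have hVi : IsSigmaInteger Sigma V.index := hι.index_open V hVn hVo
  set m : ℕ := V.index with hm
  have hmpos : 0 < m := hVi.1
  have hmlt : m < ℓ ^ m := Nat.lt_pow_self hℓ.one_lt
  haveI : NeZero (ℓ ^ m) := ⟨pow_ne_zero _ hℓ.ne_zero⟩
  have hZM : IsSigmaInteger Sigma (Nat.card (Multiplicative (ZMod (ℓ ^ m)))) := by
    rw [show Nat.card (Multiplicative (ZMod (ℓ ^ m))) = ℓ ^ m from Nat.card_zmod (ℓ ^ m)]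
    exact Literature.AnabelianGeometry.SemiGraphs.isSigmaInteger_prime_pow hℓ hℓS _
  obtain ⟨φH, X, Y, Z, hXYZ, -, hZpow, hcard⟩ := Heisenberg.exists_heisenbergTriple_central (ℓ ^ m)
  haveI : Finite (Multiplicative (ZMod (ℓ ^ m) × ZMod (ℓ ^ m)) ⋊[φH] Multiplicative (ZMod (ℓ ^ m))) :=
    Nat.finite_of_card_ne_zero (by rw [hcard]; exact pow_ne_zero _ (pow_ne_zero _ hℓ.ne_zero))
  have hHM : IsSigmaInteger Sigma
      (Nat.card (Multiplicative (ZMod (ℓ ^ m) × ZMod (ℓ ^ m)) ⋊[φH] Multiplicative (ZMod (ℓ ^ m)))) := by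
    rw [hcard, ← pow_mul]
    exact Literature.AnabelianGeometry.SemiGraphs.isSigmaInteger_prime_pow hℓ hℓS _
  have hZm : Z ^ m ≠ 1 := fun h => absurd (Nat.le_of_dvd hmpos ((hZpow m).mp h)) (not_le.mpr hmlt)
  have hW : X * Y * X⁻¹ * Y⁻¹ * Z⁻¹ = 1 := by rw [hXYZ, mul_inv_cancel]
  rintro (n₁ | c₁') (n₂ | c₂') γ₁ γ₂ hne12
  · -- loop / loop
    by_cases hn : n₁ = n₂
    · subst hn
      have hne' := hne12.resolve_left fun h => h rfl
      exact freeFactor_exists_open_separating_sameVertex hι b₀ {Sum.inl (Fin.castLE hk (eN n₁), true)}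
        (Set.singleton_nonempty _) hℓ hℓS (G.edgeGp (Sum.inl n₁)) (hEn' n₁) V hVo γ₁ γ₂ hne'
    · have hm12 : (Sum.inl (Fin.castLE hk (eN n₁), true) : (Fin g × Bool) ⊕ Fin 0) ∉
          ({Sum.inl (Fin.castLE hk (eN n₂), true)} : Set ((Fin g × Bool) ⊕ Fin 0)) := fun h => by
        rw [Set.mem_singleton_iff, Sum.inl.injEq, Prod.mk.injEq] at h
        exact hn (eN.injective (Fin.castLE_injective hk h.1))
      let ρ : PuncturedSurfaceGroup g 1 →* PuncturedSurfaceGroup g 1 :=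
        b₀.lift fun y => if y ∈ ({Sum.inl (Fin.castLE hk (eN n₂), true)} : Set ((Fin g × Bool) ⊕ Fin 0))
          then 1 else b₀ y
      have hρ : ∀ y, ρ (b₀ y) = if y ∈ ({Sum.inl (Fin.castLE hk (eN n₂), true)} :
          Set ((Fin g × Bool) ⊕ Fin 0)) then 1 else b₀ y := fun y => lift_apply_basis b₀ _ y
      have hρx : ρ (PuncturedSurfaceGroup.b (Fin.castLE hk (eN n₁))) ≠ 1 := by
        rw [← hb₀, hρ, if_neg hm12]
        exact FreeGroupBasis.apply_ne_one _ _
      exact freeFactor_exists_open_separating_crossVertex hι hSig b₀ {Sum.inl (Fin.castLE hk (eN n₂), true)}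
        ρ hρ (G.edgeGp (Sum.inl n₂)) (hEn' n₂) (G.edgeGp (Sum.inl n₁)) _ (hιb n₁) hρx V hVo γ₁ γ₂
  · -- alive: the loop `b_{m₁}`; killed: the cusp — the handle character `b_{m₁} ↦ 1 ∈ ℤ/ℓ^m`
    obtain ⟨χ, -, hχb, hχc⟩ := exists_handleCuspCharacter (g := g) (r := 1) (n := ℓ ^ m) (fun _ => 0)
      (fun i => if i = Fin.castLE hk (eN n₁) then 1 else 0) (fun _ => 0) (by simp)
    refine exists_open_separating_of_hom hι hZM χ (G.edgeGp (Sum.inr c₂')) (Subgroup.zpowers (c 0))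
      (hEc c₂') (fun x hx => ?_) (G.edgeGp (Sum.inl n₁)) _ (hιb n₁) V hVo ?_ γ₁ γ₂
    · obtain ⟨t, rfl⟩ := Subgroup.mem_zpowers_iff.mp hx
      rw [map_zpow, hχc 0, ofAdd_zero, one_zpow]
    · rw [hχb, if_pos rfl, ← ofAdd_nsmul, nsmul_eq_mul, mul_one, Ne, ofAdd_eq_one,
        ZMod.natCast_eq_zero_iff]
      exact fun h => absurd (Nat.le_of_dvd hmpos h) (not_le.mpr hmlt)
  · -- alive: the cusp; killed: the loop `b_{m₂}` — Heisenberg handle-cusp hom at a handle `i₀ ≠ m₂`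
    obtain ⟨i₀, hi₀⟩ : ∃ i₀ : Fin g, i₀ ≠ Fin.castLE hk (eN n₂) := by
      rcases hkg with h | h
      · exact ⟨⟨k, h⟩, fun h' => by
          have := congrArg Fin.val h'
          simp only [Fin.val_castLE] at this
          have := (eN n₂).isLt
          omega⟩
      · by_cases h0 : ((Fin.castLE hk (eN n₂) : Fin g) : ℕ) = 0
        · exact ⟨⟨1, h⟩, fun h' => by have := congrArg Fin.val h'; simp only at this; omega⟩
        · exact ⟨⟨0, by omega⟩, fun h' => by have := congrArg Fin.val h'; simp only at this; omega⟩
    obtain ⟨ψ, -, -, hc', hab, -⟩ := exists_hom_handle_cusp (g := g) (r := 1) i₀ 0 X Y Z⁻¹ hW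
    refine exists_open_separating_of_hom hι hHM ψ (G.edgeGp (Sum.inl n₂))
      (Subgroup.zpowers (PuncturedSurfaceGroup.b (Fin.castLE hk (eN n₂)))) (hEn n₂) (fun x hx => ?_)
      (G.edgeGp (Sum.inr c₁')) (c 0) (hιc c₁') V hVo (by rw [hc', inv_pow]; exact inv_ne_one.mpr hZm) γ₁ γ₂
    obtain ⟨t, rfl⟩ := Subgroup.mem_zpowers_iff.mp hx
    rw [map_zpow, (hab _ hi₀.symm).2, one_zpow]
  · -- cusp / cusp: the boundary-node theorem for `B = Γ_{g,1}` itself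
    have h12 : c₁' = c₂' := e.injective (by rw [hc0, hc0])
    subst h12
    have hne' := hne12.resolve_left fun h => h rfl
    exact boundaryNode_exists_open_separating_sameEdge hι b₀ Set.univ _ rfl hg
      (MonoidHom.id (PuncturedSurfaceGroup g 1)) Function.injective_id hidB hℓ hℓS
      (G.edgeGp (Sum.inr c₁')) (by rw [MonoidHom.id_apply]; exact hEc c₁') V hVo γ₁ γ₂ hne'

/-- **Row F-2827 at EVERY irreducible `k`-nodal datum with `r ≥ 1`** (`k < g ∨ 2 ≤ g ∨ 2 ≤ r`):
abc-iut-f-164's `edgeLikeSeparatingCoverings_of_irreducibleMultiNodal` for `r ≥ 2` and the one-cusp theorem.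
[cite: MochizukiCombGC2007, Prop 1.2 proof p.9] -/
theorem edgeLikeSeparatingCoverings_of_irreducibleMultiNodal' (hne : Sigma.Nonempty)
    (hprime : ∀ p ∈ Sigma, p.Prime) (ι : PuncturedSurfaceGroup g r →* P)
    (hι : IsProSigmaCompletion Sigma ι) (G : PSCDatum P) {k : ℕ} (hk : k ≤ g) (hg : 1 ≤ g) (hr : 1 ≤ r)
    (hkgr : k < g ∨ 2 ≤ g ∨ 2 ≤ r) (e : G.graph.C ≃ Fin r)
    (hC : ∀ c', G.cuspGp c' = ((cuspInertia (g := g) (e c')).map ι).topologicalClosure)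
    (eN : G.graph.N ≃ Fin k)
    (hE : ∀ m, G.nodeGp m = ((Subgroup.zpowers
      (PuncturedSurfaceGroup.b (r := r) (Fin.castLE hk (eN m)))).map ι).topologicalClosure) :
    G.EdgeLikeSeparatingCoverings := by
  by_cases h2 : 2 ≤ r
  · exact G.edgeLikeSeparatingCoverings_of_irreducibleMultiNodal hne hprime ι hι hk hg h2 e hC eN hE
  · exact G.edgeLikeSeparatingCoverings_of_irreducibleMultiNodal_oneCusp hne hprime ι hι hk
      (by rcases hkgr with h | h | h <;> omega) hg (by omega) e hC eN hE

/-- **Row F-2829 `SeparatingCoverings` (all three conjuncts) at EVERY irreducible `k`-nodal datum with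
`r ≥ 1`, `k < g ∨ 2 ≤ r`**: F-2826 abc-iut-f-164's cut-off twist, F-2827 above, F-2828 gen 4.
[cite: MochizukiCombGC2007, Prop 1.2 proof p.9] -/
theorem separatingCoverings_of_irreducibleMultiNodal' (hne : Sigma.Nonempty)
    (hprime : ∀ p ∈ Sigma, p.Prime) (ι : PuncturedSurfaceGroup g r →* P)
    (hι : IsProSigmaCompletion Sigma ι) (G : PSCDatum P) {k : ℕ} (hk : k ≤ g) (hg : 1 ≤ g) (hr : 1 ≤ r)
    (hkr : k < g ∨ 2 ≤ r) (e : G.graph.C ≃ Fin r)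
    (hC : ∀ c', G.cuspGp c' = ((cuspInertia (g := g) (e c')).map ι).topologicalClosure)
    (v₀ : G.graph.V) (hV : ∀ w, w = v₀) (eN : G.graph.N ≃ Fin k)
    (hE : ∀ m, G.nodeGp m = ((Subgroup.zpowers
      (PuncturedSurfaceGroup.b (r := r) (Fin.castLE hk (eN m)))).map ι).topologicalClosure)
    (hV₀ : G.vertGp v₀ = ((Subgroup.closure {x : PuncturedSurfaceGroup g r |
        (∃ m : Fin k, x = PuncturedSurfaceGroup.b (Fin.castLE hk m) ∨
          x = PuncturedSurfaceGroup.a (Fin.castLE hk m) * PuncturedSurfaceGroup.b (Fin.castLE hk m) *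
            (PuncturedSurfaceGroup.a (Fin.castLE hk m))⁻¹) ∨
        (∃ i : Fin g, k ≤ (i : ℕ) ∧ (x = PuncturedSurfaceGroup.a i ∨ x = PuncturedSurfaceGroup.b i)) ∨
        ∃ j : Fin r, x = PuncturedSurfaceGroup.c j}).map ι).topologicalClosure)
    (hgen : G.genus v₀ = g - k) :
    G.SeparatingCoverings :=
  ⟨G.verticialSeparatingCoverings_of_irreducibleMultiNodal' hne hprime ι hι hk hr hkr v₀ hV hV₀,
    G.edgeLikeSeparatingCoverings_of_irreducibleMultiNodal' hne hprime ι hι hk hg hr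
      (by rcases hkr with h | h; exacts [Or.inl h, Or.inr (Or.inr h)]) e hC eN hE,
    G.unrVerticialSeparatingCoverings_of_irreducibleMultiNodal hne hprime ι hι hk e hC v₀ hV eN hE hV₀ hgen⟩

/-- **[CombGC] Prop. 1.2 (i) and (ii) IN FULL at EVERY irreducible `k`-nodal datum with `r ≥ 1`,
`k < g ∨ 2 ≤ r`** (w5-d183's `prop12_of_separating` applied to F-2829 above).
[cite: MochizukiCombGC2007, Prop 1.2 pp.8-9] -/
theorem prop12_of_irreducibleMultiNodal' (hne : Sigma.Nonempty)
    (hprime : ∀ p ∈ Sigma, p.Prime) (ι : PuncturedSurfaceGroup g r →* P)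
    (hι : IsProSigmaCompletion Sigma ι) (G : PSCDatum P) {k : ℕ} (hk : k ≤ g) (hg : 1 ≤ g) (hr : 1 ≤ r)
    (hkr : k < g ∨ 2 ≤ r) (e : G.graph.C ≃ Fin r)
    (hC : ∀ c', G.cuspGp c' = ((cuspInertia (g := g) (e c')).map ι).topologicalClosure)
    (v₀ : G.graph.V) (hV : ∀ w, w = v₀) (eN : G.graph.N ≃ Fin k)
    (hE : ∀ m, G.nodeGp m = ((Subgroup.zpowers
      (PuncturedSurfaceGroup.b (r := r) (Fin.castLE hk (eN m)))).map ι).topologicalClosure)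
    (hV₀ : G.vertGp v₀ = ((Subgroup.closure {x : PuncturedSurfaceGroup g r |
        (∃ m : Fin k, x = PuncturedSurfaceGroup.b (Fin.castLE hk m) ∨
          x = PuncturedSurfaceGroup.a (Fin.castLE hk m) * PuncturedSurfaceGroup.b (Fin.castLE hk m) *
            (PuncturedSurfaceGroup.a (Fin.castLE hk m))⁻¹) ∨
        (∃ i : Fin g, k ≤ (i : ℕ) ∧ (x = PuncturedSurfaceGroup.a i ∨ x = PuncturedSurfaceGroup.b i)) ∨
        ∃ j : Fin r, x = PuncturedSurfaceGroup.c j}).map ι).topologicalClosure)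
    (hgen : G.genus v₀ = g - k) :
    (G.VerticialOpenInterDeterminesVertex ∧ G.EdgeLikeOpenInterDeterminesEdge ∧
      G.UnrVerticialOpenInterDeterminesVertex) ∧
    (G.VerticialEdgeLikeCommensurablyTerminal ∧ G.UnrVerticialCommensurablyTerminal) :=
  G.prop12_of_separating (G.separatingCoverings_of_irreducibleMultiNodal' hne hprime ι hι hk hg hr hkr e hC v₀
    hV eN hE hV₀ hgen)

end Datum

/-! ### Origin level -/

/-- **F-2830 ∧ F-0459 ∧ F-0438 rows, datum-wise, at EVERY origin whose data are irreducible `k`-nodal with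
`r ≥ 1`, `k < g ∨ 2 ≤ r`** (abc-iut-f-164's multi-nodal origin hypothesis with `2 ≤ r` relaxed).
[cite: MochizukiCombGC2007, Prop 1.2 pp.8-9] -/
theorem irreducibleMultiNodalOrigin_prop12_rows' (Ω : PSCOrigin.{0})
    (hΩ : ∀ ⦃Q : Type⦄ [Group Q] [TopologicalSpace Q] [IsTopologicalGroup Q] (G : PSCDatum Q),
      Ω.IsOfPSCType G → CompactSpace Q ∧ T2Space Q ∧ TotallyDisconnectedSpace Q ∧
        ∃ (S : Set ℕ) (g r k : ℕ) (hk : k ≤ g) (ι : PuncturedSurfaceGroup g r →* Q)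
          (e : G.graph.C ≃ Fin r) (v₀ : G.graph.V) (eN : G.graph.N ≃ Fin k),
          S.Nonempty ∧ (∀ p ∈ S, p.Prime) ∧ IsProSigmaCompletion S ι ∧ 1 ≤ g ∧ 1 ≤ r ∧ (k < g ∨ 2 ≤ r) ∧
          (∀ c, G.cuspGp c =
            ((PuncturedSurfaceGroup.cuspInertia (g := g) (e c)).map ι).topologicalClosure) ∧
          (∀ w, w = v₀) ∧
          (∀ m, G.nodeGp m = ((Subgroup.zpowers
            (PuncturedSurfaceGroup.b (r := r) (Fin.castLE hk (eN m)))).map ι).topologicalClosure) ∧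
          G.vertGp v₀ = ((Subgroup.closure {x : PuncturedSurfaceGroup g r |
            (∃ m : Fin k, x = PuncturedSurfaceGroup.b (Fin.castLE hk m) ∨
              x = PuncturedSurfaceGroup.a (Fin.castLE hk m) * PuncturedSurfaceGroup.b (Fin.castLE hk m) *
                (PuncturedSurfaceGroup.a (Fin.castLE hk m))⁻¹) ∨
            (∃ i : Fin g, k ≤ (i : ℕ) ∧ (x = PuncturedSurfaceGroup.a i ∨ x = PuncturedSurfaceGroup.b i)) ∨
            ∃ j : Fin r, x = PuncturedSurfaceGroup.c j}).map ι).topologicalClosure ∧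
          G.genus v₀ = g - k) :
    ∀ ⦃Q : Type⦄ [Group Q] [TopologicalSpace Q] [IsTopologicalGroup Q] (G : PSCDatum Q),
      Ω.IsOfPSCType G → G.SeparatingCoverings ∧
        (G.VerticialOpenInterDeterminesVertex ∧ G.EdgeLikeOpenInterDeterminesEdge ∧
          G.UnrVerticialOpenInterDeterminesVertex) ∧
        (G.VerticialEdgeLikeCommensurablyTerminal ∧ G.UnrVerticialCommensurablyTerminal) := by
  intro Q _ _ _ G hG
  obtain ⟨hc, -, hd, S, g, r, k, hk, ι, e, v₀, eN, hne, hprime, hι, hg, hr, hkr, hC, hV, hE, hV₀, hgen⟩ :=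
    hΩ G hG
  haveI := hc
  haveI := hd
  have hsep := G.separatingCoverings_of_irreducibleMultiNodal' hne hprime ι hι hk hg hr hkr e hC v₀ hV eN hE
    hV₀ hgen
  exact ⟨hsep, G.prop12_of_separating hsep⟩

/-- **Rows F-2830, F-0438 (both clauses) and F-0459 as printed, AT THE ORIGIN OF ALL IRREDUCIBLE `k`-NODAL
DATA with `r ≥ 1`, `k < g ∨ 2 ≤ r`, INHABITED by a one-cusp member** (`Γ_{3,1}` cut along two loops:
vertex genus `1`, two nodes, ONE cusp), for every nonempty set of primes `Σ`.
[cite: MochizukiCombGC2007, Prop 1.2 pp.8-9] -/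
theorem exists_irreducibleMultiNodalOneCuspOrigin_prop12_holds_all (Sigma : Set ℕ) (hne : Sigma.Nonempty)
    (hprime : ∀ p ∈ Sigma, p.Prime) :
    ∃ Ω : PSCOrigin.{0},
      (∃ (Q : ProfiniteGrp.{0}) (G : PSCDatum Q), Ω.IsOfPSCType G ∧ G.Sigma = Sigma ∧
        G.graph.i = 1 ∧ G.graph.n = 2 ∧ G.graph.r = 1) ∧
      SeparatingCoveringsHolds Ω ∧ CommensurableTerminalityHolds Ω ∧ OpenInterDeterminesComponentHolds Ω := by
  classical
  let Ω : PSCOrigin.{0} :=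
    ⟨fun {Q} _ _ G => ∃ (_ : IsTopologicalGroup Q), CompactSpace Q ∧ T2Space Q ∧ TotallyDisconnectedSpace Q ∧
      ∃ (S : Set ℕ) (g r k : ℕ) (hk : k ≤ g) (ι : PuncturedSurfaceGroup g r →* Q)
        (e : G.graph.C ≃ Fin r) (v₀ : G.graph.V) (eN : G.graph.N ≃ Fin k),
        S.Nonempty ∧ (∀ p ∈ S, p.Prime) ∧ IsProSigmaCompletion S ι ∧ 1 ≤ g ∧ 1 ≤ r ∧ (k < g ∨ 2 ≤ r) ∧
        (∀ c, G.cuspGp c =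
          ((PuncturedSurfaceGroup.cuspInertia (g := g) (e c)).map ι).topologicalClosure) ∧
        (∀ w, w = v₀) ∧
        (∀ m, G.nodeGp m = ((Subgroup.zpowers
          (PuncturedSurfaceGroup.b (r := r) (Fin.castLE hk (eN m)))).map ι).topologicalClosure) ∧
        G.vertGp v₀ = ((Subgroup.closure {x : PuncturedSurfaceGroup g r |
          (∃ m : Fin k, x = PuncturedSurfaceGroup.b (Fin.castLE hk m) ∨
            x = PuncturedSurfaceGroup.a (Fin.castLE hk m) * PuncturedSurfaceGroup.b (Fin.castLE hk m) *
              (PuncturedSurfaceGroup.a (Fin.castLE hk m))⁻¹) ∨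
          (∃ i : Fin g, k ≤ (i : ℕ) ∧ (x = PuncturedSurfaceGroup.a i ∨ x = PuncturedSurfaceGroup.b i)) ∨
          ∃ j : Fin r, x = PuncturedSurfaceGroup.c j}).map ι).topologicalClosure ∧
        G.genus v₀ = g - k⟩
  have hsep : SeparatingCoveringsHolds Ω := by
    intro Q _ _ _ G hG
    obtain ⟨_, hc, ht, hd, S, g, r, k, hk, ι, e, v₀, eN, hSne, hSp, hι, hg, hr, hkr, hC, hV, hE, hV₀, hgen⟩ :=
      hG
    haveI := hc
    haveI := hd
    exact G.separatingCoverings_of_irreducibleMultiNodal' hSne hSp ι hι hk hg hr hkr e hC v₀ hV eN hE hV₀ hgen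
  have hprof : ∀ ⦃Q : Type⦄ [Group Q] [TopologicalSpace Q] [IsTopologicalGroup Q] (G : PSCDatum Q),
      Ω.IsOfPSCType G → CompactSpace Q ∧ TotallyDisconnectedSpace Q := fun Q _ _ _ G hG => by
    obtain ⟨_, hc, -, hd, -⟩ := hG
    exact ⟨hc, hd⟩
  refine ⟨Ω, ?_, hsep, commensurableTerminalityHolds_of_separating Ω hsep hprof,
    openInterDeterminesComponentHolds_of_separating Ω hsep hprof⟩
  -- the one-cusp member: `Γ_{3,1}`, two loops (`k = 2`), vertex genus `1`
  obtain ⟨Q, ι, G, e, v₀, eN, hι, hS, hi, hn, hr, hC, hV, hE, hV₀, hgen, -⟩ :=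
    exists_irreducibleMultiNodalDatum Sigma hne hprime 3 1 2 (by norm_num)
  refine ⟨Q, G, ?_, hS, hi, hn, hr⟩
  exact ⟨inferInstance, inferInstance, inferInstance, inferInstance, Sigma, 3, 1, 2, by norm_num, ι, e, v₀, eN,
    hne, hprime, hι, by norm_num, le_rfl, Or.inl (by norm_num), hC, hV, hE, hV₀, hgen⟩

end PSCDatum

end Literature.AnabelianGeometry.SemiGraphs

end
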